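import Summits.PneNP.PneNP.Theses.KarlinRubin
import Summits.PneNP.PneNP.Theorems.KarlinRubinMonotoneSufficesStubNullMass
import Summits.PneNP.PneNP.Theorems.KarlinRubinMonotoneSufficesStubPlantedMass
import Summits.PneNP.PneNP.Theorems.KarlinRubinMonotoneSufficesStubGglrs

/-!
# Crux `MonotoneSuffices` (stmt-PneNP-18026, route KarlinRubin) — line `Sketch` (compression flow)

The crux ("computational Karlin–Rubin"): for every `δ ∈ (0, 1/2)` there is `a : ℕ` such that for
every size budget `s`, if SOME family of fan-in-2 circuits of size `≤ s n` strongly detects the planted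
`⌈n^{1/2-δ}⌉`-clique at density `1/2` (type-I + type-II error `→ 0`), then some MONOTONE family
(`{∧₂, ∨₂, 0, 1}`) of size `≤ (s n + n)^a` does too.

THE LINE (ideators r1/k1 `compression-flow` and r1/k2 `polarize-then-compress`, one lever). The
Kleitman down-up compression (= coordinate polarization) of a test `f` along one edge coordinate `e`,
`S_e f (x) = (f x[e←0] ∧ f x[e←1]) ∨ (x_e ∧ (f x[e←0] ∨ f x[e←1]))` (on every `e`-edge of the cube the
two values of `f` are sorted increasingly), never increases the crux's error sum, POINTWISE in `n`,
for EVERY `f` and EVERY `e`: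

* `stub_nullMass` — the `G(n,1/2)`-acceptance mass is preserved EXACTLY (the null law is uniform and
  `S_e` permutes values along `e`-edges);
* `stub_plantedMass` — the planted rejection mass can only fall (given the planted set `A` the law is
  uniform on the top face `Q_A = {x ⊇ E(K_A)}`; for `e ∉ E(K_A)` each `e`-edge lies inside or outside
  `Q_A`, so the accepted count in `Q_A` is unchanged; for `e ∈ E(K_A)` every point of `Q_A` is the TOP
  of its `e`-edge and receives the max);
* `stub_gglrs` — composing `S_e` over an enumeration of all coordinates yields a MONOTONE function
  (Goldreich–Goldwasser–Lehman–Ron–Samorodnitsky shifting lemma: compressing along `e` does not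
  destroy monotonicity along `e'`).

So every detector `f` owns a canonical monotone improvement `f⋆ = S_{e_N} ⋯ S_{e_1} f` with
`errSum(f⋆) ≤ errSum(f)` at every `n` and `k` ("monotone FUNCTIONS suffice", proved below from the
three stubs as `monotone_function_suffices`). The whole open content of the crux is thereby
concentrated in ONE combinatorial quantity, the monotone circuit complexity of the poset-sorted truth
table of a small detector, up to vanishing mass on the pair:

* `stub_budget` (= `CompressionBudget`, the load-bearing kernel, XL): for every small `B₂` detecting
  family `C n` there are coordinate enumerations `l n` and `{∧₂,∨₂,0,1}`-circuits `M n` of size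
  `≤ (|C n| + n)^a` that agree with `(l n)`-compression of `(C n).eval` off a set of vanishing
  null-plus-planted mass.

The composition `MonotoneSuffices_of` (PROVED below, sorry-free): `errSum(M n) ≤ errSum(f⋆ₙ) +
(disagreement mass) ≤ errSum(C n) + o(1) → 0` and `(|C n| + n)^a ≤ (s n + n)^a`.

Honest status (lead, 2026-08-17, after cycle 1). `stub_budget` is PROVABLY EQUIVALENT to the crux:
`Summit.PneNP.PneNP.Theorems.MonotoneSuffices.Compression.compressionBudget_iff_monotoneSuffices`
(tree file `KarlinRubinMonotoneSufficesCompressionKernel.lean`, p159964) — the direction crux → kernel,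
which the idea cards overlooked ("C⁺ strictly stronger"), is that ANY two strong detectors are close in
pair-measure (`μ₀{M ≠ f⋆} + μ₁{M ≠ f⋆} ≤ errSum(M) + errSum(f⋆)`). So this line REFORMULATES the crux
(canonical witness + a ladder by negation structure) and cannot reduce it; the three M-size stubs are
landed (p158325, p158559, p158939) and give the information-theoretic shadow
`monotone_function_suffices` (same file). Rungs of the ladder landed as `--supports`:
`stub_negatedInputs` (negated input VARIABLES, `×2` each; `KarlinRubinMonotoneSufficesNegatedInputs.lean`,
p159607), `stub_juntaNegations` (negations of JUNTAS on `S`, `2^{|S|}` cost;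
`KarlinRubinMonotoneSufficesJuntaNegations.lean`), `stub_oneNegation` (ONE negation gate with a monotone
argument `g` is free unless `g` is a two-sided coin, `min(μ₀{g=1}, μ₁{g=0}) ↛ 0`;
`KarlinRubinMonotoneSufficesOneNegation.lean`, p160305). DENSITY-SHIFT rungs (lead c1, namespace
`…Theorems.MonotoneSuffices.DensityShift`): the up-shift `x ↦ x ∨ 1_R` (`R` a uniformly random `r`-set of
edge slots, `r ≍ C n ≍ √N`) commutes with planting, has slice likelihood ratio `2^r C(m,r)/C(N,r) ≤
e^{2ur/N}` on `m ≤ N/2 + u` (`stub_shiftRatio`, p163389) with law `2^r C(#supp y, r)` (`stub_shiftCount`,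
p163409) and tail `≤ N/(u-r+1)²` above (`stub_shiftTail`, p163625); hence the finite SHIFT LEMMA
`stub_shiftErrSum` (p164467: some `R` gives `errSum(F(· ∨ 1_R, b)) ≤ e^{2ur/N} errSum(F(·,¬g⃗)) +
2N/(u-r+1)² + 2·avg_R Pr₀[∃ j, g_j(x ∨ 1_R) = b_j]`, EVERY `k`), the crux-format rung `stub_shiftableLayer`
(one whole layer of negations of SHIFTABLE-OR-RARE monotone gates is free at size `s n + 2`, via
`stub_diagonal` p163406) and, with `stub_thresholdSharp` (p163933, Chebyshev), `stub_thresholdNegation`: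
ONE negation of ANY edge-count threshold `[θ n ≤ #edges]` — the sharpest two-sided coin — is free
(`KarlinRubinMonotoneSufficesShiftableLayer.lean`, p165403). MIXTURE rung (same namespace): for ANY finite
family `Rs` of shift sets, AM–GM on the shifted density bounds the transported error by `η·Coll(Rs) +
errSum/η`, `Coll = E 2^{#(R∩R')}` (`stub_mixtureCount` p166009, `stub_mixtureCollision` p166190,
`stub_mixtureShiftErrSum` p167398), so a layer of negations entered by SOME bounded-collision shift family is
free (`stub_mixtureShiftableLayer`, p168372); uniform `r`-subsets of a slot set `T` have `Coll ≤ e^{r²/#T}`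
(`stub_subsetCollision` p166278) and local thresholds are `√#T`-sharp (`stub_localThresholdSharp` p166520),
so ONE negation of ANY local threshold `[θ n ≤ #(supp x ∩ T n)]` with `#T n → ∞` (degrees, cuts, edge
count) is free (`stub_localThresholdNegation`, p168372). The residue of the ladder is now R2′: negations of COARSE
two-sided monotone coins that no bounded-collision shift family enters and that are not juntas on a
pinnable block — the sibling seat's NO-GO `recMaj_shiftResistant` (RecMaj₃ on ≥ (log N)^4 un-pinnable
coordinates resists every shift law) shows this class is nonempty as a class of GATES; whether any DETECTOR
below `√n` uses such a gate essentially is exactly the crux's bet (idea card `density-shift-elimination`).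

References: D. Kleitman (1966); Goldreich–Goldwasser–Lehman–Ron–Samorodnitsky, Combinatorica 20 (2000)
(shifting lemma) [GGLRS2000]; R. O'Donnell, *Analysis of Boolean Functions* (2014), Ex. 2.52
(polarization) [ODonnell2014]; É. Tardos, Combinatorica 8 (1988) [Tardos1988]; M. Jerrum (1992),
L. Kučera (1995), Alon–Krivelevich–Sudakov (1998) (planted clique) [Jerrum1992, Kucera1995,
AlonKrivelevichSudakov1998].
-/

set_option linter.dupNamespace false -- `Summit.PneNP.PneNP.…` is the layout-mandated namespace

namespace Summit.PneNP.PneNP.Cruxes.MonotoneSuffices.Compression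

open Literature.Computability.Complexity Literature.Probability.RandomGraphs.PlantedClique Filter Finset
open Function (update)
open scoped ENNReal

/-! ### The interface -/

/-- Down-up compression (coordinate polarization) of a test `f` along the edge coordinate `e`: on each
`e`-edge `(x[e←0], x[e←1])` of the cube the two values of `f` are sorted increasingly, i.e.
`S_e f (x) = MAJ₃(x_e, f x[e←0], f x[e←1])`. -/
def compress {n : ℕ} (e : (⊤ : SimpleGraph (Fin n)).edgeSet) (f : EdgeVec n → Bool) : EdgeVec n → Bool :=
  fun x => (f (update x e false) && f (update x e true)) ||
    (x e && (f (update x e false) || f (update x e true)))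

/-- Compression along a list of coordinates (right fold: the LAST element of the list acts first). -/
def compressAll {n : ℕ} (l : List ((⊤ : SimpleGraph (Fin n)).edgeSet)) (f : EdgeVec n → Bool) :
    EdgeVec n → Bool :=
  l.foldr compress f

/-- The crux's error sum at the level of FUNCTIONS: type I under `G(n,1/2)` plus type II under the
planted `k`-clique law (`ℝ≥0∞`, verbatim the crux's expression with `(C n).eval` replaced by `f`). -/
noncomputable def errSumAt (n k : ℕ) (f : EdgeVec n → Bool) : ℝ≥0∞ :=
  (erdosRenyiHalf n).toOuterMeasure {x | f x = true} + (plantedCliqueDist n k).toOuterMeasure {x | f x = false}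

/-- `NullMassSpec`: compression preserves the null acceptance mass (content of `stub_nullMass`). -/
def NullMassSpec : Prop :=
  ∀ (n : ℕ) (e : (⊤ : SimpleGraph (Fin n)).edgeSet) (f : EdgeVec n → Bool),
    (erdosRenyiHalf n).toOuterMeasure {x | compress e f x = true} =
      (erdosRenyiHalf n).toOuterMeasure {x | f x = true}

/-- `PlantedMassSpec`: compression never increases the planted rejection mass (content of
`stub_plantedMass`). -/
def PlantedMassSpec : Prop :=
  ∀ (n k : ℕ) (e : (⊤ : SimpleGraph (Fin n)).edgeSet) (f : EdgeVec n → Bool),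
    (plantedCliqueDist n k).toOuterMeasure {x | compress e f x = false} ≤
      (plantedCliqueDist n k).toOuterMeasure {x | f x = false}

/-- `GglrsSpec`: a full pass of compressions is monotone (content of `stub_gglrs`). -/
def GglrsSpec : Prop :=
  ∀ (n : ℕ) (l : List ((⊤ : SimpleGraph (Fin n)).edgeSet)) (f : EdgeVec n → Bool),
    (∀ e, e ∈ l) → Monotone (compressAll l f)

/-- `CompressionBudget` (the kernel, content of `stub_budget`): the compressed truth table of a small
`B₂` detector has a small `{∧₂,∨₂,0,1}` circuit up to vanishing null-plus-planted mass. -/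
def CompressionBudget : Prop :=
  ∀ δ : ℝ, 0 < δ → δ < 1 / 2 → ∃ a : ℕ,
    ∀ C : (n : ℕ) → Circuit ((⊤ : SimpleGraph (Fin n)).edgeSet),
      (∀ᶠ n : ℕ in atTop, (C n).IsOver B2) →
      Tendsto (fun n : ℕ => errSumAt n ⌈(n : ℝ) ^ (1 / 2 - δ)⌉₊ (C n).eval) atTop (nhds 0) →
      ∃ (l : (n : ℕ) → List ((⊤ : SimpleGraph (Fin n)).edgeSet))
        (M : (n : ℕ) → Circuit ((⊤ : SimpleGraph (Fin n)).edgeSet)),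
        (∀ n e, e ∈ l n) ∧
        (∀ᶠ n : ℕ in atTop, (M n).IsOver monotoneBasis01 ∧ (M n).size ≤ ((C n).size + n) ^ a) ∧
        Tendsto (fun n : ℕ =>
            (erdosRenyiHalf n).toOuterMeasure {x | (M n).eval x ≠ compressAll (l n) (C n).eval x} +
              (plantedCliqueDist n ⌈(n : ℝ) ^ (1 / 2 - δ)⌉₊).toOuterMeasure
                {x | (M n).eval x ≠ compressAll (l n) (C n).eval x})
          atTop (nhds 0)

/-! ### Registered stubs

Each stub is stated in LIBRARY VOCABULARY ONLY (the interface `def`s above are unfolded: `compress e g x`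
is written out as `(g (update x e false) && g (update x e true)) || (x e && (g (update x e false) ||
g (update x e true)))`), so that a stub-worker's Theorems file can state it verbatim; `…_of_stub` below
folds them back by `rfl`. -/

/-- **stub_nullMass** (type I is preserved EXACTLY; size M). For every test `f` and every edge coordinate
`e`, the `G(n,1/2)`-mass of the acceptance set of the compression `S_e f` equals that of `f`: the null law
`erdosRenyiHalf n` is uniform on the cube (`PMF.uniformOfFintype`), and on each `e`-edge
`{x[e←0], x[e←1]}` the pair of values `(f x[e←0], f x[e←1])` is replaced by `(min, max)`, so the NUMBER
of accepted points on each `e`-edge — hence in the cube — is unchanged (`Finset.card` bijection /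
fibrewise count over `x` with `x e = false`). [cite: ODonnell2014, Ex. 2.52] [cite: GGLRS2000, §3 (sorting
operator)] -/
theorem stub_nullMass :
    ∀ (n : ℕ) (e : (⊤ : SimpleGraph (Fin n)).edgeSet) (f : EdgeVec n → Bool),
      (erdosRenyiHalf n).toOuterMeasure
          {x | ((f (update x e false) && f (update x e true)) ||
              (x e && (f (update x e false) || f (update x e true)))) = true} =
        (erdosRenyiHalf n).toOuterMeasure {x | f x = true} :=
  -- LANDED: p158325 (KarlinRubinMonotoneSufficesStubNullMass.lean)
  Summit.PneNP.PneNP.Theorems.MonotoneSuffices.Compression.stub_nullMass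

/-- **stub_plantedMass** (type II never increases; size M). For every `k`, every test `f` and every edge
coordinate `e`, the planted-law mass of the REJECTION set of `S_e f` is at most that of `f`. Fibre over
the planted set: `plantedCliqueDist n k = (uniform S ∈ kSubsets n k).bind (S ↦ (erdosRenyiHalf n).map
(plant S))` (`PMF.toOuterMeasure_bind_apply` / `_map_apply`, as in
`Summit.PneNP.PneNP.Theorems.plantedClique_errSum_locality`), so it suffices to show, for each `S`,
`#{x | S_e f (plant S x) = false} ≤ #{x | f (plant S x) = false}`. If both endpoints of `e` lie in `S`
then `plant S x e = true` and `update (plant S x) e true = plant S x`, so `S_e f (plant S x) =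
f (…[e←0]) || f (plant S x) ≥ f (plant S x)` pointwise. Otherwise `plant S` commutes with `update · e b`
(`plant_apply_of_not_inside`) and `S_e f ∘ plant S = S_e (f ∘ plant S)`, whose rejection COUNT equals
that of `f ∘ plant S` by the counting argument of `stub_nullMass`. [cite: ODonnell2014, Ex. 2.52]
[cite: Jerrum1992, §1 (the planted model)] -/
theorem stub_plantedMass :
    ∀ (n k : ℕ) (e : (⊤ : SimpleGraph (Fin n)).edgeSet) (f : EdgeVec n → Bool),
      (plantedCliqueDist n k).toOuterMeasure
          {x | ((f (update x e false) && f (update x e true)) ||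
              (x e && (f (update x e false) || f (update x e true)))) = false} ≤
        (plantedCliqueDist n k).toOuterMeasure {x | f x = false} :=
  -- LANDED: p158559 (KarlinRubinMonotoneSufficesStubPlantedMass.lean)
  Summit.PneNP.PneNP.Theorems.MonotoneSuffices.Compression.stub_plantedMass

/-- **stub_gglrs** (a full pass of compressions is monotone; size M). If the list `l` contains every
edge coordinate, then folding the compressions `S_e`, `e ∈ l`, over any test `f` gives a monotone
Boolean function (for the product order on `EdgeVec n = (edges → Bool)`). Proof: say `g` is monotone IN
DIRECTION `d` if `g x[d←0] ≤ g x[d←1]` for all `x`. (a) `S_e g` is monotone in direction `e` (min ≤ max);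
(b) if `g` is monotone in direction `d ≠ e` then so is `S_e g` (on the square `{d,e}`: `min` and `max` are
monotone maps — the GGLRS shifting lemma); (c) by induction on `l`, `l.foldr S f` is monotone in every
direction of `l`; (d) a function monotone in every coordinate direction of a finite cube is `Monotone`
(change the differing coordinates one at a time). [cite: GGLRS2000, Lemma 3 (shifting preserves
monotonicity in other dimensions)] [cite: ODonnell2014, Ex. 2.52(e)] -/
theorem stub_gglrs :
    ∀ (n : ℕ) (l : List ((⊤ : SimpleGraph (Fin n)).edgeSet)) (f : EdgeVec n → Bool),
      (∀ e, e ∈ l) →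
      Monotone (l.foldr (fun e g x => (g (update x e false) && g (update x e true)) ||
        (x e && (g (update x e false) || g (update x e true)))) f) :=
  -- LANDED: p158939 (KarlinRubinMonotoneSufficesStubGglrs.lean)
  Summit.PneNP.PneNP.Theorems.MonotoneSuffices.Compression.stub_gglrs

/-- **stub_budget** (the KERNEL `CompressionBudget`; size XL, crux-strength). For `δ ∈ (0,1/2)` there is
`a` such that for every `B₂` family `C` with error sum `→ 0` at clique size `⌈n^{1/2-δ}⌉` there are
enumerations `l n` of ALL edge coordinates and `{∧₂,∨₂,0,1}`-circuits `M n`, `|M n| ≤ (|C n| + n)^a`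
eventually, that agree with the `(l n)`-compression (poset-sort) of the truth table of `C n` off a set
whose `G(n,1/2)`-mass plus planted mass tends to `0`. Why plausibly true: on THIS pair the sorted up-set
of a detector must keep the traces of planted cliques (clique-generated up-sets) and otherwise becomes
threshold-like (ideator toy, `RigidityAndLandscape-r1k1.md` §7: order-invariant layer profile, ~10× fewer
minterms than natural monotone statistics); both have monotone complexity `poly(s)` in the contentful
window `n^{1+2δ} ≲ s ≲ n^{O(log n)}` only for the reason the crux itself is believed. Why it is the crux
of the line: it implies `MonotoneSuffices` (composition below) and, with quantitative `MonotoneBlind`,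
superpolynomial `B₂` lower bounds (`karlinRubin_noPolyDetector_of_monotoneSuffices_of_monotoneBlind`).
First rung (lead, provable now): for De Morgan detectors `D(x, ¬x_T)` with negations on `|T| ≤ c log₂(s+n)`
INPUT VARIABLES the compression along `T` is computed exactly by a monotone circuit of size
`2^{|T|}(|D| + O(1))`. Barrier: `Literature.Barriers.PneNP.MonotoneGap` (Tardos) bites the kernel if it is
read uniformly over all pairs of measures (worst case the poset-sort of a small circuit is monotone-hard:
Tardos's `ϑ`-threshold is a fixed point of compression); the statement is specific to the planted pair.
[cite: GGLRS2000, §3] [cite: Tardos1988, Thm. 1] [cite: AlonKrivelevichSudakov1998, §1] -/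
theorem stub_budget :
    ∀ δ : ℝ, 0 < δ → δ < 1 / 2 → ∃ a : ℕ,
      ∀ C : (n : ℕ) → Circuit ((⊤ : SimpleGraph (Fin n)).edgeSet),
        (∀ᶠ n : ℕ in atTop, (C n).IsOver B2) →
        Tendsto (fun n : ℕ =>
            (erdosRenyiHalf n).toOuterMeasure {x | (C n).eval x = true} +
              (plantedCliqueDist n ⌈(n : ℝ) ^ (1 / 2 - δ)⌉₊).toOuterMeasure {x | (C n).eval x = false})
          atTop (nhds 0) →
        ∃ (l : (n : ℕ) → List ((⊤ : SimpleGraph (Fin n)).edgeSet))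
          (M : (n : ℕ) → Circuit ((⊤ : SimpleGraph (Fin n)).edgeSet)),
          (∀ n e, e ∈ l n) ∧
          (∀ᶠ n : ℕ in atTop, (M n).IsOver monotoneBasis01 ∧ (M n).size ≤ ((C n).size + n) ^ a) ∧
          Tendsto (fun n : ℕ =>
              (erdosRenyiHalf n).toOuterMeasure
                  {x | (M n).eval x ≠ (l n).foldr (fun e g x => (g (update x e false) && g (update x e true)) ||
                    (x e && (g (update x e false) || g (update x e true)))) (C n).eval x} +
                (plantedCliqueDist n ⌈(n : ℝ) ^ (1 / 2 - δ)⌉₊).toOuterMeasure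
                  {x | (M n).eval x ≠ (l n).foldr (fun e g x => (g (update x e false) && g (update x e true)) ||
                    (x e && (g (update x e false) || g (update x e true)))) (C n).eval x})
            atTop (nhds 0) := by
  sorry

/-! ### Bridging the stubs to the interface (definitional unfolding) -/

/-- `NullMassSpec` from its stub. -/
theorem nullMassSpec_of_stub : NullMassSpec := stub_nullMass

/-- `PlantedMassSpec` from its stub. -/
theorem plantedMassSpec_of_stub : PlantedMassSpec := stub_plantedMass

/-- `GglrsSpec` from its stub. -/
theorem gglrsSpec_of_stub : GglrsSpec := stub_gglrs

/-- `CompressionBudget` from its stub. -/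
theorem compressionBudget_of_stub : CompressionBudget := stub_budget

/-! ### Elementary lemmas for the composition -/

/-- One compression step does not increase the error sum (from the two mass specs). -/
theorem errSumAt_compress_le (hN : NullMassSpec) (hP : PlantedMassSpec) (n k : ℕ)
    (e : (⊤ : SimpleGraph (Fin n)).edgeSet) (f : EdgeVec n → Bool) :
    errSumAt n k (compress e f) ≤ errSumAt n k f := by
  unfold errSumAt
  rw [hN n e f]
  exact add_le_add le_rfl (hP n k e f)

/-- A full list of compressions does not increase the error sum. -/
theorem errSumAt_compressAll_le (hN : NullMassSpec) (hP : PlantedMassSpec) (n k : ℕ)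
    (l : List ((⊤ : SimpleGraph (Fin n)).edgeSet)) (f : EdgeVec n → Bool) :
    errSumAt n k (compressAll l f) ≤ errSumAt n k f := by
  induction l with
  | nil => exact le_rfl
  | cons e l ih =>
    calc errSumAt n k (compressAll (e :: l) f) = errSumAt n k (compress e (compressAll l f)) := rfl
      _ ≤ errSumAt n k (compressAll l f) := errSumAt_compress_le hN hP n k e _
      _ ≤ errSumAt n k f := ih

/-- **Monotone FUNCTIONS suffice** (from the three M-size specs): every test on the edge vectors of `Kₙ`
is dominated in error sum, at every clique size `k`, by a MONOTONE Boolean function — its full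
compression. This is the information-theoretic shadow of the crux, for EVERY test (not only the optimal
one, which is monotone by the Neyman–Pearson / Karlin–Rubin argument). -/
theorem monotone_function_suffices (hN : NullMassSpec) (hP : PlantedMassSpec) (hG : GglrsSpec)
    (n k : ℕ) (f : EdgeVec n → Bool) :
    ∃ g : EdgeVec n → Bool, Monotone g ∧ errSumAt n k g ≤ errSumAt n k f :=
  ⟨compressAll (univ : Finset ((⊤ : SimpleGraph (Fin n)).edgeSet)).toList f,
    hG n _ f fun e => Finset.mem_toList.2 (mem_univ e), errSumAt_compressAll_le hN hP n k _ f⟩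

/-- Error sum of a circuit against a reference function: `errSum(M) ≤ errSum(F) + (null + planted) mass
of the disagreement set `{M ≠ F}`. -/
theorem errSumAt_le_add_disagree (n k : ℕ) (g F : EdgeVec n → Bool) :
    errSumAt n k g ≤ errSumAt n k F +
      ((erdosRenyiHalf n).toOuterMeasure {x | g x ≠ F x} +
        (plantedCliqueDist n k).toOuterMeasure {x | g x ≠ F x}) := by
  unfold errSumAt
  have h1 : (erdosRenyiHalf n).toOuterMeasure {x | g x = true} ≤
      (erdosRenyiHalf n).toOuterMeasure {x | F x = true} + (erdosRenyiHalf n).toOuterMeasure {x | g x ≠ F x} := by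
    calc (erdosRenyiHalf n).toOuterMeasure {x | g x = true}
        ≤ (erdosRenyiHalf n).toOuterMeasure ({x | F x = true} ∪ {x | g x ≠ F x}) := by
          refine MeasureTheory.measure_mono fun x hx => ?_
          simp only [Set.mem_setOf_eq, Set.mem_union] at hx ⊢
          by_cases hF : F x = true
          · exact Or.inl hF
          · exact Or.inr (by rw [hx]; exact fun h => hF h.symm)
      _ ≤ _ := MeasureTheory.measure_union_le _ _
  have h2 : (plantedCliqueDist n k).toOuterMeasure {x | g x = false} ≤
      (plantedCliqueDist n k).toOuterMeasure {x | F x = false} + (plantedCliqueDist n k).toOuterMeasure {x | g x ≠ F x} := by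
    calc (plantedCliqueDist n k).toOuterMeasure {x | g x = false}
        ≤ (plantedCliqueDist n k).toOuterMeasure ({x | F x = false} ∪ {x | g x ≠ F x}) := by
          refine MeasureTheory.measure_mono fun x hx => ?_
          simp only [Set.mem_setOf_eq, Set.mem_union] at hx ⊢
          by_cases hF : F x = false
          · exact Or.inl hF
          · exact Or.inr (by rw [hx]; exact fun h => hF h.symm)
      _ ≤ _ := MeasureTheory.measure_union_le _ _
  calc _ ≤ ((erdosRenyiHalf n).toOuterMeasure {x | F x = true} + (erdosRenyiHalf n).toOuterMeasure {x | g x ≠ F x}) +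
        ((plantedCliqueDist n k).toOuterMeasure {x | F x = false} + (plantedCliqueDist n k).toOuterMeasure {x | g x ≠ F x}) :=
        add_le_add h1 h2
    _ = _ := by ring

/-! ### The proved composition -/

/-- **The composition with explicit hypotheses** (kernel-checked, no `sorry`; conclusion = the BODY of
`KarlinRubin.MonotoneSuffices` verbatim): the two mass lemmas make compression an error-sum Lyapunov move,
the kernel supplies small monotone circuits for the compressed truth tables up to vanishing mass, and
`errSum(M n) ≤ errSum(C n) + o(1) → 0`, `(|C n| + n)^a ≤ (s n + n)^a`. (The shifting lemma `GglrsSpec` is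
not needed here — the witness is SYNTACTICALLY monotone; it is what makes the compressed table a monotone
function, i.e. what makes the kernel a statement about monotone complexity.) -/
theorem monotoneSuffices_of_specs (hN : NullMassSpec) (hP : PlantedMassSpec) (hB : CompressionBudget) :
    -- the BODY of `KarlinRubin.MonotoneSuffices`, verbatim (the skeleton theorem below restates it by name)
    ∀ δ : ℝ, 0 < δ → δ < 1 / 2 → ∃ a : ℕ, ∀ s : ℕ → ℕ, (∃ C : (n : ℕ) → Literature.Computability.Complexity.Circuit ((⊤ : SimpleGraph (Fin n)).edgeSet), (∀ᶠ n : ℕ in Filter.atTop, (C n).IsOver Literature.Computability.Complexity.B2 ∧ (C n).size ≤ s n) ∧ Filter.Tendsto (fun n : ℕ => (Literature.Probability.RandomGraphs.PlantedClique.erdosRenyiHalf n).toOuterMeasure {x | (C n).eval x = true} + (Literature.Probability.RandomGraphs.PlantedClique.plantedCliqueDist n ⌈(n : ℝ) ^ (1 / 2 - δ)⌉₊).toOuterMeasure {x | (C n).eval x = false}) Filter.atTop (nhds 0)) → ∃ C' : (n : ℕ) → Literature.Computability.Complexity.Circuit ((⊤ : SimpleGraph (Fin n)).edgeSet), (∀ᶠ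 n : ℕ in Filter.atTop, (C' n).IsOver Literature.Computability.Complexity.monotoneBasis01 ∧ (C' n).size ≤ (s n + n) ^ a) ∧ Filter.Tendsto (fun n : ℕ => (Literature.Probability.RandomGraphs.PlantedClique.erdosRenyiHalf n).toOuterMeasure {x | (C' n).eval x = true} + (Literature.Probability.RandomGraphs.PlantedClique.plantedCliqueDist n ⌈(n : ℝ) ^ (1 / 2 - δ)⌉₊).toOuterMeasure {x | (C' n).eval x = false}) Filter.atTop (nhds 0) := by
  intro δ hδ hδ'
  obtain ⟨a, ha⟩ := hB δ hδ hδ'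
  refine ⟨a, fun s hyp => ?_⟩
  obtain ⟨C, hC, hCerr⟩ := hyp
  obtain ⟨l, M, _hl, hM, hD⟩ := ha C (hC.mono fun n h => h.1) hCerr
  refine ⟨M, ?_, ?_⟩
  · filter_upwards [hM, hC] with n hMn hCn
    exact ⟨hMn.1, hMn.2.trans (Nat.pow_le_pow_left (Nat.add_le_add_right hCn.2 n) a)⟩
  · -- `errSum(M n) ≤ errSum(C n) + disagreement(n)`, both summands `→ 0`
    have hbound : ∀ n : ℕ, errSumAt n ⌈(n : ℝ) ^ (1 / 2 - δ)⌉₊ (M n).eval ≤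
        errSumAt n ⌈(n : ℝ) ^ (1 / 2 - δ)⌉₊ (C n).eval +
          ((erdosRenyiHalf n).toOuterMeasure {x | (M n).eval x ≠ compressAll (l n) (C n).eval x} +
            (plantedCliqueDist n ⌈(n : ℝ) ^ (1 / 2 - δ)⌉₊).toOuterMeasure
              {x | (M n).eval x ≠ compressAll (l n) (C n).eval x}) := fun n =>
      (errSumAt_le_add_disagree n _ (M n).eval (compressAll (l n) (C n).eval)).trans
        (add_le_add (errSumAt_compressAll_le hN hP n _ (l n) (C n).eval) le_rfl)
    have hsum := hCerr.add hD
    rw [add_zero] at hsum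
    exact tendsto_of_tendsto_of_tendsto_of_le_of_le tendsto_const_nhds hsum (fun _ => bot_le) hbound

/-- **THE SKELETON THEOREM `MonotoneSuffices_of`.** The crux
`Summit.PneNP.PneNP.Theses.KarlinRubin.MonotoneSuffices`, concluded BY NAME from the declared stubs
through the sorry-free composition `monotoneSuffices_of_specs`. -/
theorem MonotoneSuffices_of : Summit.PneNP.PneNP.Theses.KarlinRubin.MonotoneSuffices :=
  monotoneSuffices_of_specs nullMassSpec_of_stub plantedMassSpec_of_stub compressionBudget_of_stub

/-- The function-level corollary, discharged from the stubs: every test is dominated in error sum by a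
monotone Boolean function (its full compression), at every `n` and `k`. -/
theorem monotone_function_suffices_of_stubs (n k : ℕ) (f : EdgeVec n → Bool) :
    ∃ g : EdgeVec n → Bool, Monotone g ∧ errSumAt n k g ≤ errSumAt n k f :=
  monotone_function_suffices nullMassSpec_of_stub plantedMassSpec_of_stub gglrsSpec_of_stub n k f

end Summit.PneNP.PneNP.Cruxes.MonotoneSuffices.Compression
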